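import Mathlib
import Summits.KontsevichZagierPeriods.KontsevichZagierPeriods.Theorems.InverseLandauTateFamilyKernelIsotopyTwo
import Summits.KontsevichZagierPeriods.KontsevichZagierPeriods.Theorems.InverseLandauTateFamilyKernelStubFoldClass

/-!
# `TateFamilyKernel` — fold transport elements inhabit the Tate descent normal form
# (line `Sketch`, stub `stub_descentOfFold2`)

Crux `TateFamilyKernel` (stmt-KontsevichZagierPeriods-9130, route `InverseLandau`), line `Sketch`.
Data (dimension `2`; `X 0 = w₀`, `X 1 = w₁`, `X 2 = ϖ` of `ℚ[w₀, w₁, ϖ]` for the family `P/Q` and the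
fold data `c, h = B/E`): `c` vanishes on both faces `w₁ ∈ {0, 1}` (divisibilities `X 1 ∣ c`,
`(1 - X 1) ∣ c`), `E(w₀, s·c(w, ϖ₀), ϖ₀) ≠ 0` on `[0,1]² × [0,1]`, and on the closed square the fibre
`P/Q(·, ϖ₀)` IS the fold element `h(w₀, c(w, ϖ₀), ϖ₀)·(∂_{w₁}c)(w, ϖ₀)`. Conclusion
(`stub_descentOfFold2`): the `∃`-block of the research stub `stub_descentTate 0` holds at `ϖ₀` — with
ONE auxiliary cube variable (`m = 1`), THREE terms of kind (a) (Ayoub elements with rational data and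
the common denominator `E∘Φ_s`) and NO terms of kinds (d), (e) (`L = J = 0`, empty families).

Proof (the algebraic half of `stub_isotopyTwo`, p139224, specialised as in `stub_foldClass`,
p142581). On the 3-cube `(w₀, w₁, s)` put `Φ_s = (φ₁, φ₂) = (w₀, s·c)` (`φ₂ = X 2 * rename ![0,1,3] c`
in `ℚ[w₀, w₁, s, ϖ]`), `BΦ = B∘Φ`, `EΦ = E∘Φ`, and take the certificate data of `stub_isotopyTwo`:
`A₀ = −BΦ(∂₁φ₁∂₂φ₂ − ∂₂φ₁∂₁φ₂)` (here `= 0`), `A₁ = BΦ(∂₀φ₁∂₂φ₂ − ∂₂φ₁∂₀φ₂)`,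
`A₂ = −BΦ·J`, `J = ∂₀φ₁∂₁φ₂ − ∂₁φ₁∂₀φ₂ = s·(∂₁c)` (`Fold.jacobian`), all over `EΦ`, in the directions
`w₀, w₁, s`. Pointwise on `[0,1]³`: the three derivative parts sum to zero by the TRANSPORT IDENTITY
`Iso.transport` (`d Φ^*(h dy₀∧dy₁) = 0`); `A₀ = 0`; `A₁` vanishes on the faces `w₁ ∈ {0,1}` because
`∂₀φ₂`, `∂₂φ₂` do (`Iso.aeval_pderiv_eq_zero_of_eq`); and `A₂/EΦ = −h∘Φ_s·J_s` is `−`(fold element)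
at `s = 1` and `0` at `s = 0` (`Fold.aeval_bind₁_isotopy`, `Fold.aeval_X_two_mul_rename`). Hence the
sum of the three kind-(a) elements is the fold element, i.e. the fibre.
What is NOT here: the tame-representation half (that is `stub_foldClass`), kinds (d)/(e), `N > 0`.
References: Kontsevich–Zagier 2001 §1.2 rules (2), (3); Ayoub, EMS Newsl. 91 (2014) Def. 10.
-/

noncomputable section

open MeasureTheory Set MvPolynomial
open Literature.NumberTheory.Transcendental

namespace Summit.KontsevichZagierPeriods.InverseLandau.TateFamilyKernel.Descent

namespace Fold

open Iso in
/-- **The fold certificate in the research stub's normal form** (all cube types written with `2`,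
not `0 + 2`). For `c` vanishing on both `w₁`-faces, `h = B/E` with `E(w₀, s·c(w,ϖ₀), ϖ₀) ≠ 0` on
`[0,1]² × [0,1]`, and a fibre `P/Q(·,ϖ₀) = h(w₀, c, ϖ₀)·∂₁c` on the closed square, the `∃`-block of
`stub_descentTate 0` holds with `m = 1`, `K = 3`, `L = J = 0`: data `A = ![A₀, A₁, A₂]` of
`stub_isotopyTwo` for `φ₁ = X 0`, `φ₂ = X 2 * rename ![0,1,3] c`, common denominator `E∘Φ_s`,
directions `![0, 1, 2]`; the pointwise identity is `Iso.transport` + face vanishing + the two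
`s`-faces of `−h∘Φ_s·J_s`. [cite: KontsevichZagier2001, §1.2 rules (2), (3)] [cite: Ayoub2014, Def. 10] -/
theorem descent_certificate (P Q : MvPolynomial (Fin (2 + 1)) ℚ)
    (cf Bh Eh : MvPolynomial (Fin (2 + 1)) ℚ)
    (hc0 : ∃ R : MvPolynomial (Fin (2 + 1)) ℚ, cf = X 1 * R)
    (hc1 : ∃ R : MvPolynomial (Fin (2 + 1)) ℚ, cf = (1 - X 1) * R)
    (ϖ₀ : ℝ)
    (hEh : ∀ w ∈ KZ.cube 2, ∀ s ∈ Icc (0 : ℝ) 1,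
      aeval (Fin.snoc (![w 0, s * aeval (Fin.snoc w ϖ₀ : Fin (2 + 1) → ℝ) cf] : Fin 2 → ℝ) ϖ₀ :
        Fin (2 + 1) → ℝ) Eh ≠ 0)
    (hfib : ∀ w ∈ KZ.cube 2,
      aeval (Fin.snoc w ϖ₀ : Fin (2 + 1) → ℝ) P / aeval (Fin.snoc w ϖ₀ : Fin (2 + 1) → ℝ) Q =
        aeval (Fin.snoc (![w 0, aeval (Fin.snoc w ϖ₀ : Fin (2 + 1) → ℝ) cf] : Fin 2 → ℝ) ϖ₀ :
            Fin (2 + 1) → ℝ) Bh /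
          aeval (Fin.snoc (![w 0, aeval (Fin.snoc w ϖ₀ : Fin (2 + 1) → ℝ) cf] : Fin 2 → ℝ) ϖ₀ :
            Fin (2 + 1) → ℝ) Eh *
          aeval (Fin.snoc w ϖ₀ : Fin (2 + 1) → ℝ) (pderiv 1 cf)) :
    ∃ (m K : ℕ) (A Dn : Fin K → MvPolynomial (Fin (2 + m + 1)) ℚ) (i : Fin K → Fin (2 + m))
        (L : ℕ) (B E : Fin L → MvPolynomial (Fin (2 + m + 1)) ℚ)
        (σ : Fin L → Equiv.Perm (Fin (2 + m))) (S : Fin L → Finset (Fin (2 + m)))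
        (J : ℕ) (d c : Fin J → ℕ) (e : ∀ j, Fin (d j + c j) ≃ Fin (2 + m))
        (Pj Qj : ∀ j, MvPolynomial (Fin (d j + 1)) ℚ) (bj : Fin J → ℝ)
        (Bj Ej : ∀ j, MvPolynomial (Fin (c j + 1)) ℚ),
        (∀ k, ∀ w ∈ KZ.cube (2 + m), aeval (Fin.snoc w ϖ₀ : Fin (2 + m + 1) → ℝ) (Dn k) ≠ 0) ∧
        (∀ l, ∀ w ∈ KZ.cube (2 + m), aeval (Fin.snoc w ϖ₀ : Fin (2 + m + 1) → ℝ) (E l) ≠ 0) ∧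
        (∀ j, d j ≤ 0 + 1) ∧
        (∀ j, ∃ c₀ : ℚ, c₀ ≠ 0 ∧ ∀ y : Fin (d j) → ℝ,
          aeval (Fin.snoc y (0 : ℝ) : Fin (d j + 1) → ℝ) (Qj j) = (c₀ : ℝ)) ∧
        (∀ j (y : Fin (d j) → ℝ) (ϖ : ℝ), (∀ t, y t ∈ Icc (0 : ℝ) 1) → ϖ ∈ Ioo 0 (bj j) →
          aeval (Fin.snoc y ϖ : Fin (d j + 1) → ℝ) (Qj j) ≠ 0) ∧
        (∀ j, ∀ ϖ ∈ Ioo 0 (bj j), ∫ y in Set.pi Set.univ (fun _ : Fin (d j) => Ioo (0 : ℝ) 1),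
          aeval (Fin.snoc y ϖ : Fin (d j + 1) → ℝ) (Pj j) / aeval (Fin.snoc y ϖ : Fin (d j + 1) → ℝ) (Qj j) = 0) ∧
        (∀ j, ϖ₀ ∈ Ioo 0 (bj j)) ∧
        (∀ j, ∀ y ∈ KZ.cube (c j), aeval (Fin.snoc y ϖ₀ : Fin (c j + 1) → ℝ) (Ej j) ≠ 0) ∧
        (∀ w ∈ KZ.cube (2 + m),
          aeval (Fin.snoc (fun t => w (Fin.castAdd m t)) ϖ₀ : Fin (2 + 1) → ℝ) P /
              aeval (Fin.snoc (fun t => w (Fin.castAdd m t)) ϖ₀ : Fin (2 + 1) → ℝ) Q =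
            (∑ k : Fin K,
              (aeval (Fin.snoc w ϖ₀ : Fin (2 + m + 1) → ℝ)
                  (pderiv (Fin.castSucc (i k)) (A k) * Dn k - A k * pderiv (Fin.castSucc (i k)) (Dn k)) /
                aeval (Fin.snoc w ϖ₀ : Fin (2 + m + 1) → ℝ) (Dn k ^ 2)
              - aeval (Fin.snoc (Function.update w (i k) 1) ϖ₀ : Fin (2 + m + 1) → ℝ) (A k) /
                  aeval (Fin.snoc (Function.update w (i k) 1) ϖ₀ : Fin (2 + m + 1) → ℝ) (Dn k)
              + aeval (Fin.snoc (Function.update w (i k) 0) ϖ₀ : Fin (2 + m + 1) → ℝ) (A k) /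
                  aeval (Fin.snoc (Function.update w (i k) 0) ϖ₀ : Fin (2 + m + 1) → ℝ) (Dn k))) +
            (∑ l : Fin L,
              (aeval (Fin.snoc w ϖ₀ : Fin (2 + m + 1) → ℝ) (B l) /
                  aeval (Fin.snoc w ϖ₀ : Fin (2 + m + 1) → ℝ) (E l) -
                aeval (Fin.snoc (fun t => if t ∈ S l then 1 - w (σ l t) else w (σ l t)) ϖ₀ :
                    Fin (2 + m + 1) → ℝ) (B l) /
                  aeval (Fin.snoc (fun t => if t ∈ S l then 1 - w (σ l t) else w (σ l t)) ϖ₀ :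
                    Fin (2 + m + 1) → ℝ) (E l))) +
            (∑ j : Fin J,
              aeval (Fin.snoc (fun t => w (e j (Fin.castAdd (c j) t))) ϖ₀ : Fin (d j + 1) → ℝ) (Pj j) /
                  aeval (Fin.snoc (fun t => w (e j (Fin.castAdd (c j) t))) ϖ₀ : Fin (d j + 1) → ℝ) (Qj j) *
                (aeval (Fin.snoc (fun t => w (e j (Fin.natAdd (d j) t))) ϖ₀ : Fin (c j + 1) → ℝ) (Bj j) /
                  aeval (Fin.snoc (fun t => w (e j (Fin.natAdd (d j) t))) ϖ₀ : Fin (c j + 1) → ℝ) (Ej j)))) := by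
  obtain ⟨R₀, hR₀⟩ := hc0
  obtain ⟨R₁, hR₁⟩ := hc1
  -- `E∘Φ_s ≠ 0` on the closed cube `[0,1]³` (the hypothesis `hEh` at `s = w₂`)
  have hE : ∀ w ∈ KZ.cube (2 + 1), aeval (Fin.snoc w ϖ₀ : Fin (2 + 1 + 1) → ℝ)
      (bind₁ ![X 0, X 2 * rename (![0, 1, 3] : Fin (2 + 1) → Fin (2 + 1 + 1)) cf, X 3] Eh) ≠ 0 := by
    intro w hw
    rw [← Fin.snoc_init_self (q := w)] at hw ⊢
    obtain ⟨hz, hs0, hs1⟩ := KZ.snoc_mem_cube_iff.1 hw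
    rw [aeval_bind₁_isotopy]
    exact hEh _ hz _ ⟨hs0, hs1⟩
  -- the isotopy `Φ_s = (X 0, φ₂)`, `φ₂ = s · c(w₀, w₁, ϖ)`
  set φ₂ : MvPolynomial (Fin (2 + 1 + 1)) ℚ :=
    X 2 * rename (![0, 1, 3] : Fin (2 + 1) → Fin (2 + 1 + 1)) cf with hφ₂
  -- the transport identity for `B∘Φ`, `E∘Φ`
  have key := transport (φ₁ := (X 0 : MvPolynomial (Fin (2 + 1 + 1)) ℚ)) (φ₂ := φ₂)
    (fun i hi => pderiv_bind₁_three (X 0) φ₂ Bh hi) (fun i hi => pderiv_bind₁_three (X 0) φ₂ Eh hi)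
  -- names for the certificate data (`X 0 = w₀`, `X 1 = w₁`, `X 2 = s`, `X 3 = ϖ`)
  set EΦ : MvPolynomial (Fin (2 + 1 + 1)) ℚ := bind₁ ![X 0, φ₂, X 3] Eh with hEΦ
  set BΦ : MvPolynomial (Fin (2 + 1 + 1)) ℚ := bind₁ ![X 0, φ₂, X 3] Bh with hBΦ
  set A₀ : MvPolynomial (Fin (2 + 1 + 1)) ℚ :=
    -(BΦ * (pderiv 1 (X 0 : MvPolynomial (Fin (2 + 1 + 1)) ℚ) * pderiv 2 φ₂ -
      pderiv 2 (X 0 : MvPolynomial (Fin (2 + 1 + 1)) ℚ) * pderiv 1 φ₂)) with hA₀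
  set A₁ : MvPolynomial (Fin (2 + 1 + 1)) ℚ :=
    BΦ * (pderiv 0 (X 0 : MvPolynomial (Fin (2 + 1 + 1)) ℚ) * pderiv 2 φ₂ -
      pderiv 2 (X 0 : MvPolynomial (Fin (2 + 1 + 1)) ℚ) * pderiv 0 φ₂) with hA₁
  set A₂ : MvPolynomial (Fin (2 + 1 + 1)) ℚ :=
    -(BΦ * (pderiv 0 (X 0 : MvPolynomial (Fin (2 + 1 + 1)) ℚ) * pderiv 1 φ₂ -
      pderiv 1 (X 0 : MvPolynomial (Fin (2 + 1 + 1)) ℚ) * pderiv 0 φ₂)) with hA₂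
  -- face structure of `φ₂`: both faces `w₁ ∈ {0,1}` go to the edge `y₁ = 0`
  have hP₂ : φ₂ = C 0 + X 1 * (X 2 * rename (![0, 1, 3] : Fin (2 + 1) → Fin (2 + 1 + 1)) R₀) := by
    rw [hφ₂, hR₀, map_mul, rename_X, C_0, zero_add]
    show X 2 * (X 1 * rename (![0, 1, 3] : Fin (2 + 1) → Fin (2 + 1 + 1)) R₀) = _
    ring
  have hP₂' : φ₂ = C 0 + (1 - X 1) * (X 2 * rename (![0, 1, 3] : Fin (2 + 1) → Fin (2 + 1 + 1)) R₁) := by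
    rw [hφ₂, hR₁, map_mul, map_sub, map_one, rename_X, C_0, zero_add]
    show X 2 * ((1 - X 1) * rename (![0, 1, 3] : Fin (2 + 1) → Fin (2 + 1 + 1)) R₁) = _
    ring
  have hd10 : pderiv (1 : Fin (2 + 1 + 1)) (X 0 : MvPolynomial (Fin (2 + 1 + 1)) ℚ) = 0 :=
    pderiv_X_of_ne (by decide)
  have hd20 : pderiv (2 : Fin (2 + 1 + 1)) (X 0 : MvPolynomial (Fin (2 + 1 + 1)) ℚ) = 0 :=
    pderiv_X_of_ne (by decide)
  have hd01 : pderiv (0 : Fin (2 + 1 + 1)) (X 1 : MvPolynomial (Fin (2 + 1 + 1)) ℚ) = 0 :=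
    pderiv_X_of_ne (by decide)
  have hd21 : pderiv (2 : Fin (2 + 1 + 1)) (X 1 : MvPolynomial (Fin (2 + 1 + 1)) ℚ) = 0 :=
    pderiv_X_of_ne (by decide)
  have hd01' : pderiv (0 : Fin (2 + 1 + 1)) (1 - X 1 : MvPolynomial (Fin (2 + 1 + 1)) ℚ) = 0 := by
    rw [map_sub, pderiv_one, hd01, sub_zero]
  have hd21' : pderiv (2 : Fin (2 + 1 + 1)) (1 - X 1 : MvPolynomial (Fin (2 + 1 + 1)) ℚ) = 0 := by
    rw [map_sub, pderiv_one, hd21, sub_zero]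
  -- `A₀ = 0` (the `w₀`-component of the isotopy is the identity) and `A₁ = 0` on the `w₁`-faces
  have hA₀v : ∀ v : Fin (2 + 1 + 1) → ℝ, aeval v A₀ = 0 := fun v => by
    simp only [hA₀, hd10, hd20, zero_mul, sub_self, mul_zero, neg_zero, map_zero]
  have hA₁v : ∀ v : Fin (2 + 1 + 1) → ℝ, aeval v (pderiv 0 φ₂) = 0 → aeval v (pderiv 2 φ₂) = 0 →
      aeval v A₁ = 0 := fun v h1 h2 => by
    simp only [hA₁, map_mul, map_sub, h1, h2, mul_zero, sub_zero]
  -- the `s`-faces of `A₂/EΦ = −h∘Φ_s·J_s`: the fold element at `s = 1`, zero at `s = 0`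
  have hA₂1 : ∀ z : Fin 2 → ℝ,
      aeval (Fin.snoc (Fin.snoc z 1 : Fin (2 + 1) → ℝ) ϖ₀ : Fin (2 + 1 + 1) → ℝ) A₂ =
        -(aeval (Fin.snoc (![z 0, aeval (Fin.snoc z ϖ₀ : Fin (2 + 1) → ℝ) cf] : Fin 2 → ℝ) ϖ₀ :
            Fin (2 + 1) → ℝ) Bh * aeval (Fin.snoc z ϖ₀ : Fin (2 + 1) → ℝ) (pderiv 1 cf)) := fun z => by
    simp only [hA₂, hBΦ, hφ₂, map_neg, map_mul, aeval_bind₁_isotopy, jacobian, aeval_X,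
      aeval_rename_reindex, Gap.snoc4_2, Gap.snoc3_2, one_mul]
  have hA₂0 : ∀ z : Fin 2 → ℝ,
      aeval (Fin.snoc (Fin.snoc z 0 : Fin (2 + 1) → ℝ) ϖ₀ : Fin (2 + 1 + 1) → ℝ) A₂ = 0 := fun z => by
    simp only [hA₂, hBΦ, hφ₂, map_neg, map_mul, jacobian, aeval_X, Gap.snoc4_2, Gap.snoc3_2,
      zero_mul, mul_zero, neg_zero]
  have hE1 : ∀ z : Fin 2 → ℝ,
      aeval (Fin.snoc (Fin.snoc z 1 : Fin (2 + 1) → ℝ) ϖ₀ : Fin (2 + 1 + 1) → ℝ) EΦ =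
        aeval (Fin.snoc (![z 0, aeval (Fin.snoc z ϖ₀ : Fin (2 + 1) → ℝ) cf] : Fin 2 → ℝ) ϖ₀ :
          Fin (2 + 1) → ℝ) Eh := fun z => by
    rw [hEΦ, hφ₂, aeval_bind₁_isotopy, one_mul]
  have hc2 : (Fin.castSucc (2 : Fin (2 + 1)) : Fin (2 + 1 + 1)) = 2 := rfl
  -- the witnesses: `m = 1`, three kind-(a) terms, no kind-(d)/(e) terms
  refine ⟨1, 3, ![A₀, A₁, A₂], fun _ => EΦ, ![0, 1, 2], 0, Fin.elim0, Fin.elim0, Fin.elim0, Fin.elim0,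
    0, Fin.elim0, Fin.elim0, fun j => j.elim0, fun j => j.elim0, fun j => j.elim0, Fin.elim0,
    fun j => j.elim0, fun j => j.elim0, fun _ => hE, fun l => l.elim0, fun j => j.elim0,
    fun j => j.elim0, fun j => j.elim0, fun j => j.elim0, fun j => j.elim0, fun j => j.elim0,
    fun w hw => ?_⟩
  -- the pointwise certificate identity on `[0,1]³`
  have hz : (fun j : Fin 2 => w (Fin.castAdd 1 j)) ∈ KZ.cube 2 := fun j => KZ.mem_cube.1 hw _
  rw [hfib _ hz, Fin.sum_univ_three, Fin.sum_univ_zero, Fin.sum_univ_zero, add_zero, add_zero]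
  simp only [Matrix.cons_val_zero, Matrix.cons_val_one, Matrix.cons_val_two, Matrix.head_cons,
    Matrix.tail_cons, Fin.castSucc_zero, Fin.castSucc_one, hc2]
  -- the faces `w₀ ∈ {0,1}` of `A₀/EΦ` and `w₁ ∈ {0,1}` of `A₁/EΦ` vanish
  have f10 : aeval (Fin.snoc (Function.update w 1 0) ϖ₀ : Fin (2 + 1 + 1) → ℝ) A₁ = 0 :=
    hA₁v _
      (aeval_pderiv_eq_zero_of_eq hP₂ hd01 (by rw [aeval_X, Gap.snoc4_1, Function.update_self]))
      (aeval_pderiv_eq_zero_of_eq hP₂ hd21 (by rw [aeval_X, Gap.snoc4_1, Function.update_self]))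
  have f11 : aeval (Fin.snoc (Function.update w 1 1) ϖ₀ : Fin (2 + 1 + 1) → ℝ) A₁ = 0 :=
    hA₁v _ (aeval_pderiv_eq_zero_of_eq hP₂' hd01'
        (by rw [map_sub, map_one, aeval_X, Gap.snoc4_1, Function.update_self, sub_self]))
      (aeval_pderiv_eq_zero_of_eq hP₂' hd21'
        (by rw [map_sub, map_one, aeval_X, Gap.snoc4_1, Function.update_self, sub_self]))
  rw [hA₀v, hA₀v, f10, f11, zero_div, zero_div]
  -- the derivative parts sum to zero by the transport identity
  have hsum : aeval (Fin.snoc w ϖ₀ : Fin (2 + 1 + 1) → ℝ) (pderiv 0 A₀ * EΦ - A₀ * pderiv 0 EΦ) /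
        aeval (Fin.snoc w ϖ₀ : Fin (2 + 1 + 1) → ℝ) (EΦ ^ 2) +
      aeval (Fin.snoc w ϖ₀ : Fin (2 + 1 + 1) → ℝ) (pderiv 1 A₁ * EΦ - A₁ * pderiv 1 EΦ) /
        aeval (Fin.snoc w ϖ₀ : Fin (2 + 1 + 1) → ℝ) (EΦ ^ 2) +
      aeval (Fin.snoc w ϖ₀ : Fin (2 + 1 + 1) → ℝ) (pderiv 2 A₂ * EΦ - A₂ * pderiv 2 EΦ) /
        aeval (Fin.snoc w ϖ₀ : Fin (2 + 1 + 1) → ℝ) (EΦ ^ 2) = 0 := by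
    rw [← add_div, ← add_div, ← map_add, ← map_add, key, map_zero, zero_div]
  -- the `s`-faces of `A₂/EΦ`
  rw [snoc_update_two w 1 ϖ₀, snoc_update_two w 0 ϖ₀, hA₂1, hA₂0, hE1]
  linear_combination -hsum

end Fold

/-- STUB `stub_descentOfFold2` of line `Sketch` — **fold transport elements inhabit the research
stub's normal form** (dimension `2`, `m = 1`, no symmetry and no product terms). If the fibre
`P/Q(·,ϖ₀)` on the closed square is a FOLD ELEMENT `h(w₀, c(w,ϖ₀), ϖ₀)·∂_{w₁}c(w,ϖ₀)` (`c = 0` on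
both `w₁`-faces, `h = B/E` regular along `{(w₀, s·c)}`), then the `∃` of `stub_descentTate 0` holds
at `ϖ₀` with `m = 1`, `K = 3`, `L = J = 0`: on the 3-cube `(w₀, w₁, s)` the transport identity
(`Iso.transport`) for `Φ_s = (w₀, s·c)` reads `∂_s(h∘Φ_s·J_s) = ∂_{w₀}K₀ + ∂_{w₁}K₁` with rational
`K₀ = 0`, `K₁` vanishing on the `w₁`-faces and `h∘Φ·J` equal to the fold element at `s = 1`, `0` at
`s = 0`; hence pointwise `F = relA_{w₀}(K₀) + relA_{w₁}(K₁) + relA_s(−h∘Φ·J)` — three Ayoub elements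
with rational data over the denominator `E(w₀, s·c, ϖ₀) ≠ 0` on the closed 3-cube
(`Fold.descent_certificate`, read at the definitionally equal types `Fin (0 + 2 + ·)`).
[cite: KontsevichZagier2001, §1.2 rules (2), (3)] [cite: Ayoub2014, Def. 10] -/
theorem stub_descentOfFold2 (P Q : MvPolynomial (Fin (0 + 2 + 1)) ℚ)
    (cf Bh Eh : MvPolynomial (Fin (2 + 1)) ℚ)
    (hc0 : ∃ R : MvPolynomial (Fin (2 + 1)) ℚ, cf = X 1 * R)
    (hc1 : ∃ R : MvPolynomial (Fin (2 + 1)) ℚ, cf = (1 - X 1) * R)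
    (ϖ₀ : ℝ) (halg : IsAlgebraic ℚ ϖ₀)
    (hEh : ∀ w ∈ KZ.cube 2, ∀ s ∈ Icc (0 : ℝ) 1,
      aeval (Fin.snoc (![w 0, s * aeval (Fin.snoc w ϖ₀ : Fin (2 + 1) → ℝ) cf] : Fin 2 → ℝ) ϖ₀ :
        Fin (2 + 1) → ℝ) Eh ≠ 0)
    (hfib : ∀ w ∈ KZ.cube 2,
      aeval (Fin.snoc w ϖ₀ : Fin (0 + 2 + 1) → ℝ) P / aeval (Fin.snoc w ϖ₀ : Fin (0 + 2 + 1) → ℝ) Q =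
        aeval (Fin.snoc (![w 0, aeval (Fin.snoc w ϖ₀ : Fin (2 + 1) → ℝ) cf] : Fin 2 → ℝ) ϖ₀ :
            Fin (2 + 1) → ℝ) Bh /
          aeval (Fin.snoc (![w 0, aeval (Fin.snoc w ϖ₀ : Fin (2 + 1) → ℝ) cf] : Fin 2 → ℝ) ϖ₀ :
            Fin (2 + 1) → ℝ) Eh *
          aeval (Fin.snoc w ϖ₀ : Fin (2 + 1) → ℝ) (pderiv 1 cf)) :
    ∃ (m K : ℕ) (A Dn : Fin K → MvPolynomial (Fin (0 + 2 + m + 1)) ℚ) (i : Fin K → Fin (0 + 2 + m))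
        (L : ℕ) (B E : Fin L → MvPolynomial (Fin (0 + 2 + m + 1)) ℚ)
        (σ : Fin L → Equiv.Perm (Fin (0 + 2 + m))) (S : Fin L → Finset (Fin (0 + 2 + m)))
        (J : ℕ) (d c : Fin J → ℕ) (e : ∀ j, Fin (d j + c j) ≃ Fin (0 + 2 + m))
        (Pj Qj : ∀ j, MvPolynomial (Fin (d j + 1)) ℚ) (bj : Fin J → ℝ)
        (Bj Ej : ∀ j, MvPolynomial (Fin (c j + 1)) ℚ),
        (∀ k, ∀ w ∈ KZ.cube (0 + 2 + m), aeval (Fin.snoc w ϖ₀ : Fin (0 + 2 + m + 1) → ℝ) (Dn k) ≠ 0) ∧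
        (∀ l, ∀ w ∈ KZ.cube (0 + 2 + m), aeval (Fin.snoc w ϖ₀ : Fin (0 + 2 + m + 1) → ℝ) (E l) ≠ 0) ∧
        (∀ j, d j ≤ 0 + 1) ∧
        (∀ j, ∃ c₀ : ℚ, c₀ ≠ 0 ∧ ∀ y : Fin (d j) → ℝ,
          aeval (Fin.snoc y (0 : ℝ) : Fin (d j + 1) → ℝ) (Qj j) = (c₀ : ℝ)) ∧
        (∀ j (y : Fin (d j) → ℝ) (ϖ : ℝ), (∀ t, y t ∈ Icc (0 : ℝ) 1) → ϖ ∈ Ioo 0 (bj j) →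
          aeval (Fin.snoc y ϖ : Fin (d j + 1) → ℝ) (Qj j) ≠ 0) ∧
        (∀ j, ∀ ϖ ∈ Ioo 0 (bj j), ∫ y in Set.pi Set.univ (fun _ : Fin (d j) => Ioo (0 : ℝ) 1),
          aeval (Fin.snoc y ϖ : Fin (d j + 1) → ℝ) (Pj j) / aeval (Fin.snoc y ϖ : Fin (d j + 1) → ℝ) (Qj j) = 0) ∧
        (∀ j, ϖ₀ ∈ Ioo 0 (bj j)) ∧
        (∀ j, ∀ y ∈ KZ.cube (c j), aeval (Fin.snoc y ϖ₀ : Fin (c j + 1) → ℝ) (Ej j) ≠ 0) ∧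
        (∀ w ∈ KZ.cube (0 + 2 + m),
          aeval (Fin.snoc (fun t => w (Fin.castAdd m t)) ϖ₀ : Fin (0 + 2 + 1) → ℝ) P /
              aeval (Fin.snoc (fun t => w (Fin.castAdd m t)) ϖ₀ : Fin (0 + 2 + 1) → ℝ) Q =
            (∑ k : Fin K,
              (aeval (Fin.snoc w ϖ₀ : Fin (0 + 2 + m + 1) → ℝ)
                  (pderiv (Fin.castSucc (i k)) (A k) * Dn k - A k * pderiv (Fin.castSucc (i k)) (Dn k)) /
                aeval (Fin.snoc w ϖ₀ : Fin (0 + 2 + m + 1) → ℝ) (Dn k ^ 2)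
              - aeval (Fin.snoc (Function.update w (i k) 1) ϖ₀ : Fin (0 + 2 + m + 1) → ℝ) (A k) /
                  aeval (Fin.snoc (Function.update w (i k) 1) ϖ₀ : Fin (0 + 2 + m + 1) → ℝ) (Dn k)
              + aeval (Fin.snoc (Function.update w (i k) 0) ϖ₀ : Fin (0 + 2 + m + 1) → ℝ) (A k) /
                  aeval (Fin.snoc (Function.update w (i k) 0) ϖ₀ : Fin (0 + 2 + m + 1) → ℝ) (Dn k))) +
            (∑ l : Fin L,
              (aeval (Fin.snoc w ϖ₀ : Fin (0 + 2 + m + 1) → ℝ) (B l) /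
                  aeval (Fin.snoc w ϖ₀ : Fin (0 + 2 + m + 1) → ℝ) (E l) -
                aeval (Fin.snoc (fun t => if t ∈ S l then 1 - w (σ l t) else w (σ l t)) ϖ₀ :
                    Fin (0 + 2 + m + 1) → ℝ) (B l) /
                  aeval (Fin.snoc (fun t => if t ∈ S l then 1 - w (σ l t) else w (σ l t)) ϖ₀ :
                    Fin (0 + 2 + m + 1) → ℝ) (E l))) +
            (∑ j : Fin J,
              aeval (Fin.snoc (fun t => w (e j (Fin.castAdd (c j) t))) ϖ₀ : Fin (d j + 1) → ℝ) (Pj j) /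
                  aeval (Fin.snoc (fun t => w (e j (Fin.castAdd (c j) t))) ϖ₀ : Fin (d j + 1) → ℝ) (Qj j) *
                (aeval (Fin.snoc (fun t => w (e j (Fin.natAdd (d j) t))) ϖ₀ : Fin (c j + 1) → ℝ) (Bj j) /
                  aeval (Fin.snoc (fun t => w (e j (Fin.natAdd (d j) t))) ϖ₀ : Fin (c j + 1) → ℝ) (Ej j)))) := by
  have _ := halg
  exact Fold.descent_certificate P Q cf Bh Eh hc0 hc1 ϖ₀ hEh hfib

end Summit.KontsevichZagierPeriods.InverseLandau.TateFamilyKernel.Descent
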